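import Summits.BirchSwinnertonDyer.Rank2.F2DensityAlgebra
import HarnessLib

/-!
# Route `CountingDoorF2AtThree`, crux I4loc `SchneiderOnDoorSubfamily` (stmt-BirchSwinnertonDyer-19682) —
# registered stub `stub_hasDensityOn_one_of_forall` of line `valuation-class-at-three`

Cell `bsd-rank2`, seat `bsd-rank2-cd-density-one` (PART 1b ACCEL row (5); `--supports
stmt-BirchSwinnertonDyer-19682`). Skeleton of record:
`Cruxes/SchneiderOnDoorSubfamily/Lines/valuation_class_at_three.lean` (sha 8a36fd83eb0e, registered
2026-08-26T14:06:28Z), whose composition `SchneiderOnDoorSubfamily_of` consumes this stub as `h4`.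

THEOREMS ONLY (pure bookkeeping on Bhargava–Ho's height-ordered family `F₂`; no definition, no named
fact, no `sorry`; nothing reads an analytic rank). The stub, token for token as registered:
if a congruence subfamily `Φ` of `F₂` has a member and EVERY member satisfies `P`, then `P` holds for
100 % of `Φ` ordered by height (`Φ.HasDensityOn P 1`, i.e. `proportionOn Φ P X → 1`). Proof: a member
`a` lies in the height ball `Φ.below X` for every `X > height a` (`CongruenceFamily₂.mem_below_iff`),
so the balls are eventually nonempty; on a nonempty ball the proportion of an always-true property is
`1` (tree theorem `Summit.BirchSwinnertonDyer.Rank2.proportionOn_eq_one_of_forall`); an eventually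
constant sequence tends to its constant (`tendsto_const_nhds.congr'`). The member hypothesis is
needed: with no member every ball is empty, every proportion is the junk value `0`, and the density
is `0`, not `1` (`hasDensityOn_zero_of_forall_not_mem` below records this).

* `eventually_card_below_pos_of_mem` — a member ⇒ `∀ᶠ X, 0 < #(Φ.below X)` (the nonemptiness
  hypothesis of the tree's transfer lemmas, cf. `Rank2.eventually_card_below_pos_all`).
* `proportionOn_eventuallyEq_one_of_forall` — a member + `P` on every member ⇒ `proportionOn Φ P =ᶠ 1`.
* `stub_hasDensityOn_one_of_forall` — THE REGISTERED STUB.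
* `hasDensityOn_zero_of_forall_not_mem` — why `hex` is not idle.
-/

set_option autoImplicit false
-- the Theorems namespace of a single-conjunct summit repeats the summit name by design (D-0017)
set_option linter.dupNamespace false

open Filter Topology
open Literature.NumberTheory.EllipticCurves.BhargavaHo2022

namespace Summit.BirchSwinnertonDyer.BirchSwinnertonDyer.Theorems.CountingDoorF2AtThreeSchneiderOnDoorSubfamilyStubHasDensityOnOneOfForall

/-- **A subfamily with a member has nonempty height balls from that member's height on**: if
`Φ.Mem a` then `0 < #(Φ.below X)` for all large `X` (indeed for every `X > height a`). [folklore] -/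
theorem eventually_card_below_pos_of_mem (Φ : CongruenceFamily₂) {a : Params} (ha : Φ.Mem a) :
    ∀ᶠ X : ℕ in atTop, 0 < (Φ.below X).card :=
  (tendsto_natCast_atTop_atTop.eventually (eventually_gt_atTop a.height)).mono fun X hX ↦
    Finset.card_pos.2 ⟨a, (Φ.mem_below_iff a X).2 ⟨ha, hX⟩⟩

/-- **The proportion of an everywhere-true property is eventually the constant `1`**: if `Φ` has a
member and every member of `Φ` satisfies `P`, then `proportionOn Φ P X = 1` for all large `X`. [folklore] -/
theorem proportionOn_eventuallyEq_one_of_forall (Φ : CongruenceFamily₂) {P : Params → Prop}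
    (hex : ∃ a, Φ.Mem a) (hall : ∀ a, Φ.Mem a → P a) :
    Φ.proportionOn P =ᶠ[atTop] fun _ ↦ (1 : ℝ) := by
  obtain ⟨a, ha⟩ := hex
  exact (eventually_card_below_pos_of_mem Φ ha).mono fun X hX ↦
    Summit.BirchSwinnertonDyer.Rank2.proportionOn_eq_one_of_forall Φ hall hX

/-- **STUB 4 of line `valuation-class-at-three` (registered signature, token for token) — every
member ⇒ density one.** If the congruence subfamily `Φ` of `F₂` has a member and every member
satisfies `P`, then `P` holds with density one along the height: `Φ.HasDensityOn P 1`
(the proportions are eventually the constant `1`, `proportionOn_eventuallyEq_one_of_forall`). [folklore] -/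
theorem stub_hasDensityOn_one_of_forall (Φ : CongruenceFamily₂) (P : Params → Prop)
    (hex : ∃ a, Φ.Mem a) (hall : ∀ a, Φ.Mem a → P a) : Φ.HasDensityOn P 1 := by
  unfold CongruenceFamily₂.HasDensityOn
  exact tendsto_const_nhds.congr' (proportionOn_eventuallyEq_one_of_forall Φ hex hall).symm

/-- **Why the member hypothesis is needed**: a subfamily with NO member has every height ball empty,
so every proportion is the junk value `0` and every property has density `0` (in particular not `1`).
[folklore] -/
theorem hasDensityOn_zero_of_forall_not_mem (Φ : CongruenceFamily₂) (P : Params → Prop)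
    (hno : ∀ a, ¬ Φ.Mem a) : Φ.HasDensityOn P 0 := by
  unfold CongruenceFamily₂.HasDensityOn
  refine tendsto_const_nhds.congr' (Eventually.of_forall fun X ↦ ?_)
  classical
  have hempty : Φ.below X = ∅ :=
    Finset.eq_empty_of_forall_notMem fun a ha ↦ hno a ((Φ.mem_below_iff a X).1 ha).1
  rw [Summit.BirchSwinnertonDyer.Rank2.proportionOn_eq_card_filter_div Φ P X, hempty]
  simp

end Summit.BirchSwinnertonDyer.BirchSwinnertonDyer.Theorems.CountingDoorF2AtThreeSchneiderOnDoorSubfamilyStubHasDensityOnOneOfForall
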